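import Summits.NavierStokesRegularity.FluidComputer.SmoothedHillVortexField
import Mathlib.MeasureTheory.Constructions.HaarToSphere
import Mathlib.MeasureTheory.Measure.Lebesgue.VolumeOfBalls
import HarnessLib

/-!
# The smoothed Hill spherical vortex, VI: the two Gallay–Šverák integrals `∫ ω_θ/r` and `∫ r² ω_θ/r`

Cell `ns-blowup`, seat `ns-blowup-fc-prover-3` (g6); sequel of `SmoothedHillVortexField` (IV).
LABEL: kinematics (proved lemmas; no named fact). WHAT THIS IS NOT: not NS evidence — the two data
integrals of the Gallay–Šverák speed cap (`GallaySverak2015.speedCap_eighth`: `‖u(t)‖_∞ ≤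
0.35356 √(√((∫η₀)(∫r²η₀)) · sup η₀)`, `η₀ = ω_θ/r` of the datum) evaluated for the explicit LAZY
ENVELOPE SLICE of crux `HeredityAtOne`'s negative lane (stmt-NavierStokesRegularity-19249).

For `u = hillField M a b` (`0 ≤ M`, `0 < a < b`), `η = ω_θ/r = η₁(|x|²)` is radial, continuous, in
`[0, M]`, supported in the ball of radius `b`; by integration in polar coordinates
(`MeasureTheory.integral_fun_norm_addHaar`, `|B₁| = 4π/3`):

* `integrable_angVortQuot_hillField`, `integrable_norm_sq_mul_angVortQuot_hillField`,
  `integrable_cylRadius_sq_mul_angVortQuot_hillField`;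
* `integral_angVortQuot_hillField_le`: `∫ η ≤ (4π/3) M b³` (`moment2_le`);
* `integral_norm_sq_mul_angVortQuot_hillField`: `∫ |x|² η = 4π K` (`K = tailConst`, the fourth
  moment of the profile) — hence `∫ r² η ≤ ∫ |x|² η ≤ (4π/5) M b⁵`
  (`integral_cylRadius_sq_mul_angVortQuot_hillField_le`).

References: Th. Gallay, V. Šverák, Confluentes Math. 7 (2015), Prop. 2.6 (2.14), Lemma 5.1, Lemma 6.4
[cite: GallaySverak2016, Prop. 2.6 (2.14), Lemma 5.1, Lemma 6.4 (arXiv pp. 8, 16, 19)];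
M. J. M. Hill, Phil. Trans. R. Soc. London A 185 (1894) 213–245 [cite: Hill1894, Art. 1–4].
-/

noncomputable section

open Real Set Function MeasureTheory Filter Topology Metric
open scoped ContDiff ENNReal

namespace Summit.NavierStokesRegularity.FluidComputer

namespace SmoothedHill

open Literature.Analysis.FluidPDE

variable {M a b : ℝ}

/-! ## The radial moments of the profile -/

/-- The second-moment integrand is interval integrable. [folklore] -/
theorem intervalIntegrable_moment2_integrand (M a b c d : ℝ) :
    IntervalIntegrable (fun ρ : ℝ => ρ ^ 2 * quot M a b (ρ ^ 2)) volume c d :=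
  ((continuous_pow 2).mul ((continuous_quot M a b).comp (continuous_pow 2))).intervalIntegrable _ _

/-- The second moment `∫₀ᵇ ρ² η₁(ρ²) dρ ≤ M b³/3` (`0 ≤ M`, `0 ≤ a < b`). [folklore] -/
theorem moment2_le (hM : 0 ≤ M) (ha : 0 ≤ a) (hab : a < b) :
    ∫ ρ in (0 : ℝ)..b, ρ ^ 2 * quot M a b (ρ ^ 2) ≤ M * b ^ 3 / 3 := by
  have hb : 0 ≤ b := ha.trans hab.le
  calc ∫ ρ in (0 : ℝ)..b, ρ ^ 2 * quot M a b (ρ ^ 2)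
      ≤ ∫ ρ in (0 : ℝ)..b, M * ρ ^ 2 := by
        refine intervalIntegral.integral_mono_on hb (intervalIntegrable_moment2_integrand M a b 0 b)
          ((continuous_const.mul (continuous_pow 2)).intervalIntegrable _ _) fun ρ hρ => ?_
        rw [mul_comm]
        exact mul_le_mul_of_nonneg_right (quot_le hM _ _ _) (by positivity)
    _ = M * b ^ 3 / 3 := by rw [intervalIntegral.integral_const_mul, integral_pow]; ring

/-! ## The vorticity quotient as a radial function -/

/-- `ω_θ/r (x) = η₁(‖x‖²)`. [folklore] -/
theorem angVortQuot_hillField_eq (ha : 0 < a) (hab : a < b) :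
    angVortQuot (hillField M a b) = fun x => quot M a b (‖x‖ ^ 2) := by
  funext x; rw [angVortQuot_hillField ha hab, rsq_eq_norm_sq]

/-- `ω_θ/r` is continuous. [folklore] -/
theorem continuous_angVortQuot_hillField (ha : 0 < a) (hab : a < b) :
    Continuous (angVortQuot (hillField M a b)) := by
  rw [angVortQuot_hillField_eq ha hab]
  exact (continuous_quot M a b).comp (continuous_norm.pow 2)

/-- `ω_θ/r` vanishes off the closed ball of radius `b`. [folklore] -/
theorem angVortQuot_hillField_eq_zero (ha : 0 < a) (hab : a < b) {x : EuclideanSpace ℝ (Fin 3)}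
    (hx : b ≤ ‖x‖) : angVortQuot (hillField M a b) x = 0 := by
  have hb : 0 < b := ha.trans hab
  rw [angVortQuot_hillField_eq ha hab]
  exact quot_of_ge ha.le hab (by nlinarith [norm_nonneg x])

/-- `ω_θ/r` has compact support (inside the closed ball of radius `b`). [folklore] -/
theorem hasCompactSupport_angVortQuot_hillField (ha : 0 < a) (hab : a < b) :
    HasCompactSupport (angVortQuot (hillField M a b)) := by
  refine HasCompactSupport.of_support_subset_isCompact (isCompact_closedBall (0 : EuclideanSpace ℝ (Fin 3)) b)
    fun x hx => ?_
  rw [mem_closedBall, dist_zero_right]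
  by_contra h
  exact hx (angVortQuot_hillField_eq_zero ha hab (not_le.1 h).le)

/-- **`ω_θ/r ∈ L¹`.** [folklore] -/
theorem integrable_angVortQuot_hillField (ha : 0 < a) (hab : a < b) :
    Integrable (angVortQuot (hillField M a b)) :=
  (continuous_angVortQuot_hillField ha hab).integrable_of_hasCompactSupport
    (hasCompactSupport_angVortQuot_hillField ha hab)

/-- **`|x|² ω_θ/r ∈ L¹`.** [folklore] -/
theorem integrable_norm_sq_mul_angVortQuot_hillField (ha : 0 < a) (hab : a < b) :
    Integrable (fun x : EuclideanSpace ℝ (Fin 3) => ‖x‖ ^ 2 * angVortQuot (hillField M a b) x) :=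
  ((continuous_norm.pow 2).mul (continuous_angVortQuot_hillField ha hab)).integrable_of_hasCompactSupport
    ((hasCompactSupport_angVortQuot_hillField ha hab).mul_left)

/-- **`r² ω_θ/r ∈ L¹`** (the impulse density). [folklore] -/
theorem integrable_cylRadius_sq_mul_angVortQuot_hillField (ha : 0 < a) (hab : a < b) :
    Integrable (fun x : EuclideanSpace ℝ (Fin 3) => cylRadius x ^ 2 * angVortQuot (hillField M a b) x) :=
  ((continuous_cylRadius.pow 2).mul (continuous_angVortQuot_hillField ha hab)).integrable_of_hasCompactSupport
    ((hasCompactSupport_angVortQuot_hillField ha hab).mul_left)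

/-! ## Polar coordinates -/

/-- The unit ball of `ℝ³` has volume `4π/3`. [folklore] -/
theorem volume_real_unitBall_three :
    (volume : Measure (EuclideanSpace ℝ (Fin 3))).real (ball 0 1) = 4 * π / 3 := by
  rw [Measure.real, EuclideanSpace.volume_ball_fin_three]
  simp only [ENNReal.ofReal_one, one_pow, one_mul]
  rw [ENNReal.toReal_ofReal (by positivity)]
  ring

/-- Radial integration of a profile vanishing beyond `b`: for `F` with `F r = 0` for `r ≥ b`
(`0 ≤ b`), `∫ F(‖x‖) dx = 4π ∫₀ᵇ r² F(r) dr` (polar coordinates; no integrability hypothesis is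
needed, both sides being junk-consistent). [folklore] -/
theorem integral_radial_eq {F : ℝ → ℝ} (hb : 0 ≤ b)
    (hz : ∀ r, b ≤ r → F r = 0) :
    ∫ x : EuclideanSpace ℝ (Fin 3), F ‖x‖ = 4 * π * ∫ r in (0 : ℝ)..b, r ^ 2 * F r := by
  rw [MeasureTheory.integral_fun_norm_addHaar volume F, volume_real_unitBall_three,
    finrank_euclideanSpace_fin]
  have h1 : ∫ y in Ioi (0 : ℝ), y ^ (3 - 1) • F y = ∫ y in Ioc (0 : ℝ) b, y ^ 2 * F y := by
    rw [setIntegral_eq_of_subset_of_forall_sdiff_eq_zero measurableSet_Ioi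
      (Ioc_subset_Ioi_self : Ioc (0 : ℝ) b ⊆ Ioi 0)]
    · simp [smul_eq_mul]
    · intro y hy
      have hy' : b < y := by
        simp only [Set.mem_sdiff, mem_Ioi, mem_Ioc, not_and, not_le] at hy
        exact hy.2 hy.1
      simp [hz y hy'.le]
  rw [h1, ← intervalIntegral.integral_of_le hb]
  simp only [nsmul_eq_mul, smul_eq_mul, Nat.cast_ofNat]
  ring

/-! ## The two integrals -/

/-- **`∫ ω_θ/r = 4π m₂(b) ≤ (4π/3) M b³`** (`0 ≤ M`, `0 < a < b`).
[cite: GallaySverak2016, Lemma 5.1 (arXiv p. 16)] -/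
theorem integral_angVortQuot_hillField_le (hM : 0 ≤ M) (ha : 0 < a) (hab : a < b) :
    ∫ x, angVortQuot (hillField M a b) x ≤ 4 * π / 3 * M * b ^ 3 := by
  have hb : 0 < b := ha.trans hab
  rw [angVortQuot_hillField_eq ha hab]
  have h := integral_radial_eq (b := b) (F := fun r => quot M a b (r ^ 2)) hb.le
    (fun r hr => quot_of_ge ha.le hab (by nlinarith))
  rw [h]
  have hm := moment2_le hM ha.le hab
  nlinarith [Real.pi_pos]

/-- **`∫ |x|² ω_θ/r = 4π K`** (`K = tailConst`, the fourth moment; `0 < a < b`). [folklore] -/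
theorem integral_norm_sq_mul_angVortQuot_hillField (ha : 0 < a) (hab : a < b) :
    ∫ x : EuclideanSpace ℝ (Fin 3), ‖x‖ ^ 2 * angVortQuot (hillField M a b) x =
      4 * π * tailConst M a b := by
  have hb : 0 < b := ha.trans hab
  rw [angVortQuot_hillField_eq ha hab]
  have h := integral_radial_eq (b := b) (F := fun r => r ^ 2 * quot M a b (r ^ 2)) hb.le
    (fun r hr => by simp [quot_of_ge ha.le hab (show b ^ 2 ≤ r ^ 2 by nlinarith)])
  rw [h, tailConst, moment]
  congr 1
  refine intervalIntegral.integral_congr fun r _ => ?_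
  show r ^ 2 * (r ^ 2 * quot M a b (r ^ 2)) = r ^ 4 * quot M a b (r ^ 2)
  ring

/-- `∫ |x|² ω_θ/r ≤ (4π/5) M b⁵` (`0 ≤ M`, `0 < a < b`). [folklore] -/
theorem integral_norm_sq_mul_angVortQuot_hillField_le (hM : 0 ≤ M) (ha : 0 < a) (hab : a < b) :
    ∫ x : EuclideanSpace ℝ (Fin 3), ‖x‖ ^ 2 * angVortQuot (hillField M a b) x ≤ 4 * π / 5 * M * b ^ 5 := by
  rw [integral_norm_sq_mul_angVortQuot_hillField ha hab]
  have := tailConst_le hM ha.le hab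
  nlinarith [Real.pi_pos]

/-- **`∫ r² ω_θ/r ≤ (4π/5) M b⁵`** (`r` = distance to the axis `≤ |x|`, `ω_θ/r ≥ 0`; `0 ≤ M`,
`0 < a < b`). [cite: GallaySverak2016, Lemma 6.4 (arXiv p. 19)] -/
theorem integral_cylRadius_sq_mul_angVortQuot_hillField_le (hM : 0 ≤ M) (ha : 0 < a) (hab : a < b) :
    ∫ x : EuclideanSpace ℝ (Fin 3), cylRadius x ^ 2 * angVortQuot (hillField M a b) x ≤
      4 * π / 5 * M * b ^ 5 := by
  refine le_trans (integral_mono (integrable_cylRadius_sq_mul_angVortQuot_hillField ha hab)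
    (integrable_norm_sq_mul_angVortQuot_hillField ha hab) fun x => ?_)
    (integral_norm_sq_mul_angVortQuot_hillField_le hM ha hab)
  have hη := angVortQuot_hillField_nonneg hM ha hab x
  have hr : cylRadius x ^ 2 ≤ ‖x‖ ^ 2 := by
    rw [cylRadius_sq, ← rsq_eq_norm_sq]; exact cyl_sq_le_rsq x
  exact mul_le_mul_of_nonneg_right hr hη

end SmoothedHill

end Summit.NavierStokesRegularity.FluidComputer

end
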